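import Mathlib
import HarnessLib
import Literature.Probability.LatticeModels.LatticeGraph

/-!
# BalabanIR engine `BirComplexStableXY` (stmt-HubbardSuperconductivity-2080): time-reflection reality

Support lemmas for crux 2 of route BalabanIR (`--supports stmt-HubbardSuperconductivity-2080`).

The refuter/ideator record on the item (Crux2_TransferZeros.md, Disproof.lean, the two crux-ideate
analyses) says the engine is suspect-false AS TYPED: for admissible Fourier tables with an EVEN
imaginary temporal stiffness the partition function `Z = ∫ exp(-A)` has Beraha–Kahane–Weiss zeros
(two equimodular dominant transfer eigenvalues with DIFFERENT PHASES) at `M ~ K² L⁴`, and the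
recommended repair is the time-reflection reality hypothesis

  (R)  `F (φ ∘ R) = conj (F φ)` for every real window configuration `φ`,
       `R (w₁, w₂, w₃) = (w₁, w₂, rev w₃)` the temporal reflection of the window `Fin r³`

(in table form `c (n ∘ R) = conj (c (-n))`; satisfied by every fermion-induced action).

This file proves the first structural consequence of (R) for the objects EXACTLY as they are typed
in `Theses.BalabanIR.BirComplexStableXY` (same `sh`, `F`, `A`, `cube`, `Z`, `O`): under (R), for
every `r`, every real `K` and all `L, M ≥ 1`,

* the action is time-reflection Hermitian: `A (θ ∘ ρ) = conj (A θ)` for the measure-preserving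
  involution `ρ (x, t) = (x, -t)` of the space-time torus (`action_comp_timeReflection`);
* `conj Z = Z` and `conj (∫ O·exp(-A)) = ∫ O·exp(-A)` (`partitionFunction_conj_eq_self`,
  `sliceOrderNumerator_conj_eq_self`): both are REAL numbers, so in the repaired class a zero of
  `Z` can only be a sign change of a real-analytic real function of the couplings — the
  equimodular-doublet-with-distinct-phases mechanism of the typed counterexample is unavailable,
  and the slice-order ratio is the real quotient `Re ∫O e^{-A} / Re Z`
  (`sliceOrder_re_eq_div_of_timeReflection`).

The abstract input is a change of variables on the cube `[a,b]^ι` under a coordinate permutation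
(`setIntegral_cube_comp_equiv`, Mathlib `volume_measurePreserving_piCongrLeft`) and
`integral_conj`; cf. `Literature.MathematicalPhysics.QuantumFieldTheory.setIntegral_brillouin_comp_equiv`.
-/

namespace Summit.HubbardSuperconductivity.HubbardSuperconductivity.Theorems

open scoped BigOperators ComplexConjugate
open MeasureTheory

/-- Change of variables on a cube: for a permutation `e` of the coordinates, the integral of
`f (p ∘ e)` over `[a,b]^ι` equals the integral of `f` (Lebesgue measure and the cube are
permutation invariant; Mathlib `volume_measurePreserving_piCongrLeft`). -/
theorem setIntegral_cube_comp_equiv {ι : Type*} [Fintype ι] (e : ι ≃ ι) (a b : ℝ)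
    (f : (ι → ℝ) → ℂ) :
    ∫ p in Set.pi Set.univ (fun _ : ι => Set.Icc a b), f (fun l => p (e l)) =
      ∫ p in Set.pi Set.univ (fun _ : ι => Set.Icc a b), f p := by
  have hF : ∀ p : ι → ℝ,
      (MeasurableEquiv.piCongrLeft (fun _ : ι => ℝ) e.symm p : ι → ℝ) = fun l => p (e l) := by
    intro p
    funext l
    have h := MeasurableEquiv.piCongrLeft_apply_apply (β := fun _ : ι => ℝ) e.symm p (e l)
    rwa [Equiv.symm_apply_apply] at h
  have hpre : (MeasurableEquiv.piCongrLeft (fun _ : ι => ℝ) e.symm) ⁻¹'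
      (Set.pi Set.univ (fun _ : ι => Set.Icc a b)) = Set.pi Set.univ (fun _ : ι => Set.Icc a b) := by
    ext p
    simp only [Set.mem_preimage, Set.mem_univ_pi, hF]
    exact ⟨fun h l => by simpa using h (e.symm l), fun h l => h (e l)⟩
  have key := (volume_measurePreserving_piCongrLeft (fun _ : ι => ℝ) e.symm).setIntegral_preimage_emb
    (MeasurableEquiv.piCongrLeft (fun _ : ι => ℝ) e.symm).measurableEmbedding f
    (Set.pi Set.univ (fun _ : ι => Set.Icc a b))
  rw [hpre] at key
  simp_rw [hF] at key
  exact key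

/-- Reality from an antiunitary symmetry: if `f (p ∘ e) = conj (f p)` for a coordinate
permutation `e`, then `∫_{[a,b]^ι} f` is real (`conj` of it is itself). -/
theorem conj_setIntegral_cube_eq_self {ι : Type*} [Fintype ι] (e : ι ≃ ι) (a b : ℝ)
    (f : (ι → ℝ) → ℂ) (hf : ∀ p, f (fun l => p (e l)) = conj (f p)) :
    conj (∫ p in Set.pi Set.univ (fun _ : ι => Set.Icc a b), f p) =
      ∫ p in Set.pi Set.univ (fun _ : ι => Set.Icc a b), f p := by
  rw [← integral_conj]
  simp_rw [← hf]
  exact setIntegral_cube_comp_equiv e a b f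

/-- The time reflection `ρ (x, t) = (x, -t)` of the anisotropic space-time torus
`(ℤ/L)² × (ℤ/M)`, as a permutation of the sites (an involution). -/
theorem timeReflection_involutive (L M : ℕ) :
    Function.Involutive (fun s : Literature.Probability.LatticeModels.TorusSite 2 L × ZMod M =>
      (s.1, -s.2)) := by
  intro s
  simp

/-- Window bookkeeping for the time reflection: reflecting the space-time torus by
`ρ (x,t) = (x,-t)` maps the window attached at `(x, t)` onto the window attached at
`(x, -t - (r-1))`, read backwards in time (`w₃ ↦ rev w₃`). -/
theorem timeReflection_sh (r M : ℕ) (t : ZMod M) (w : Fin r × Fin r × Fin r) :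
    -(t + ((w.2.2 : ℕ) : ZMod M)) =
      (-t - ((r - 1 : ℕ) : ZMod M)) + (((Fin.rev w.2.2 : Fin r) : ℕ) : ZMod M) := by
  have hr : (w.2.2 : ℕ) + 1 ≤ r := w.2.2.isLt
  have h1 : ((r - 1 : ℕ) : ZMod M) = (r : ZMod M) - 1 := by
    rw [Nat.cast_sub (by omega)]; simp
  have h2 : (((Fin.rev w.2.2 : Fin r) : ℕ) : ZMod M) = (r : ZMod M) - ((w.2.2 : ℕ) : ZMod M) - 1 := by
    rw [Fin.val_rev, Nat.cast_sub hr]; push_cast; ring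
  rw [h1, h2]; ring

open Literature.Probability.LatticeModels in
/-- **Time-reflection Hermiticity of the action.** Under the reality hypothesis (R)
`F (φ ∘ R) = conj (F φ)` (functional form; `R (w₁,w₂,w₃) = (w₁,w₂,rev w₃)`), the window action
`A θ = K Σ_s F (θ ∘ sh s)` of `BirComplexStableXY` satisfies `A (θ ∘ ρ) = conj (A θ)` for the time
reflection `ρ (x,t) = (x,-t)`, for every real `K` and all `L, M ≥ 1` (the windows are relabelled by
the involution `(x,t) ↦ (x, -t-(r-1))` and read backwards, `timeReflection_sh`). -/
theorem action_comp_timeReflection (r : ℕ) (c : ((Fin r × Fin r × Fin r) → ℤ) →₀ ℂ) (K : ℝ)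
    (L M : ℕ) [NeZero L] [NeZero M]
    (hR : ∀ φ : (Fin r × Fin r × Fin r) → ℝ,
      c.sum (fun n a => a * Complex.exp (Complex.I *
        ((∑ w, (n w : ℝ) * φ (w.1, w.2.1, Fin.rev w.2.2) : ℝ) : ℂ))) =
      conj (c.sum (fun n a => a * Complex.exp (Complex.I * ((∑ w, (n w : ℝ) * φ w : ℝ) : ℂ)))))
    (θ : (TorusSite 2 L × ZMod M) → ℝ) :
    let sh : (TorusSite 2 L × ZMod M) → (Fin r × Fin r × Fin r) → (TorusSite 2 L × ZMod M) :=
      fun s w => (s.1 + ![((w.1 : ℕ) : ZMod L), ((w.2.1 : ℕ) : ZMod L)], s.2 + ((w.2.2 : ℕ) : ZMod M))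
    let F : ((Fin r × Fin r × Fin r) → ℝ) → ℂ := fun φ =>
      c.sum (fun n a => a * Complex.exp (Complex.I * ((∑ w, (n w : ℝ) * φ w : ℝ) : ℂ)))
    let A : ((TorusSite 2 L × ZMod M) → ℝ) → ℂ := fun θ => (K : ℂ) * ∑ s, F (fun w => θ (sh s w))
    A (fun s => θ (s.1, -s.2)) = conj (A θ) := by
  intro sh F A
  -- the window relabelling `σ (x,t) = (x, -t-(r-1))`, an involution of the space-time torus
  set d : ZMod M := ((r - 1 : ℕ) : ZMod M) with hd
  have hσ : Function.Involutive (fun s : TorusSite 2 L × ZMod M => (s.1, -s.2 - d)) := by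
    intro s; ext <;> simp
  let σ : Equiv.Perm (TorusSite 2 L × ZMod M) := hσ.toPerm _
  -- each reflected window is a relabelled window read backwards in time
  have hwin : ∀ s : TorusSite 2 L × ZMod M,
      (fun w : Fin r × Fin r × Fin r => θ ((sh s w).1, -(sh s w).2)) =
        fun w => (fun w' => θ (sh (σ s) w')) (w.1, w.2.1, Fin.rev w.2.2) := by
    intro s
    funext w
    show θ (_, _) = θ (_, _)
    congr 1
    ext1
    · rfl
    · show -(s.2 + ((w.2.2 : ℕ) : ZMod M)) = (-s.2 - d) + (((Fin.rev w.2.2 : Fin r) : ℕ) : ZMod M)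
      rw [hd]
      exact timeReflection_sh r M s.2 w
  have hK : conj (K : ℂ) = (K : ℂ) := Complex.conj_ofReal K
  show (K : ℂ) * ∑ s, F (fun w => θ ((sh s w).1, -(sh s w).2)) =
    conj ((K : ℂ) * ∑ s, F (fun w => θ (sh s w)))
  rw [map_mul, hK, map_sum]
  congr 1
  calc ∑ s, F (fun w => θ ((sh s w).1, -(sh s w).2))
      = ∑ s, conj (F (fun w => θ (sh (σ s) w))) := by
        refine Finset.sum_congr rfl fun s _ => ?_
        rw [hwin s]
        exact hR (fun w' => θ (sh (σ s) w'))
    _ = ∑ s, conj (F (fun w => θ (sh s w))) :=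
        Equiv.sum_comp σ (fun s => conj (F (fun w => θ (sh s w))))

open Literature.Probability.LatticeModels in
/-- **Reality of the partition function in the time-reflection class.** Under (R), the complex
partition function `Z = ∫_{[0,2π]^Λ} exp(-A θ) dθ` of `BirComplexStableXY` (same `sh`, `F`, `A`,
`cube` as in the route file) satisfies `conj Z = Z` for every `r`, real `K` and `L, M ≥ 1`: in the
repaired class `Z` is a real number, so it can vanish only through a sign change (the
equimodular-doublet-with-distinct-phases mechanism of the typed counterexample is excluded). -/
theorem partitionFunction_conj_eq_self (r : ℕ) (c : ((Fin r × Fin r × Fin r) → ℤ) →₀ ℂ) (K : ℝ)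
    (L M : ℕ) [NeZero L] [NeZero M]
    (hR : ∀ φ : (Fin r × Fin r × Fin r) → ℝ,
      c.sum (fun n a => a * Complex.exp (Complex.I *
        ((∑ w, (n w : ℝ) * φ (w.1, w.2.1, Fin.rev w.2.2) : ℝ) : ℂ))) =
      conj (c.sum (fun n a => a * Complex.exp (Complex.I * ((∑ w, (n w : ℝ) * φ w : ℝ) : ℂ))))) :
    let sh : (TorusSite 2 L × ZMod M) → (Fin r × Fin r × Fin r) → (TorusSite 2 L × ZMod M) :=
      fun s w => (s.1 + ![((w.1 : ℕ) : ZMod L), ((w.2.1 : ℕ) : ZMod L)], s.2 + ((w.2.2 : ℕ) : ZMod M))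
    let F : ((Fin r × Fin r × Fin r) → ℝ) → ℂ := fun φ =>
      c.sum (fun n a => a * Complex.exp (Complex.I * ((∑ w, (n w : ℝ) * φ w : ℝ) : ℂ)))
    let A : ((TorusSite 2 L × ZMod M) → ℝ) → ℂ := fun θ => (K : ℂ) * ∑ s, F (fun w => θ (sh s w))
    let cube : Set ((TorusSite 2 L × ZMod M) → ℝ) := Set.pi Set.univ (fun _ => Set.Icc (0:ℝ) (2 * Real.pi))
    let Z : ℂ := MeasureTheory.integral (MeasureTheory.volume.restrict cube) (fun θ => Complex.exp (-(A θ)))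
    conj Z = Z := by
  intro sh F A cube Z
  have hρ : Function.Involutive (fun s : TorusSite 2 L × ZMod M => (s.1, -s.2)) :=
    timeReflection_involutive L M
  refine conj_setIntegral_cube_eq_self (hρ.toPerm _) 0 (2 * Real.pi) (fun θ => Complex.exp (-(A θ))) ?_
  intro θ
  show Complex.exp (-(A (fun s => θ (s.1, -s.2)))) = conj (Complex.exp (-(A θ)))
  rw [← Complex.exp_conj, map_neg]
  exact congrArg (fun z => Complex.exp (-z)) (action_comp_timeReflection r c K L M hR θ)

open Literature.Probability.LatticeModels in
/-- **Reality of the slice-order numerator in the time-reflection class.** Under (R),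
`∫_{[0,2π]^Λ} O(θ) exp(-A θ) dθ` with the equal-time slice observable
`O θ = |Σ_x e^{iθ(x,0)}|² / L⁴` of `BirComplexStableXY` is real as well (the time reflection
`(x,t) ↦ (x,-t)` fixes the slice `t = 0`). -/
theorem sliceOrderNumerator_conj_eq_self (r : ℕ) (c : ((Fin r × Fin r × Fin r) → ℤ) →₀ ℂ) (K : ℝ)
    (L M : ℕ) [NeZero L] [NeZero M]
    (hR : ∀ φ : (Fin r × Fin r × Fin r) → ℝ,
      c.sum (fun n a => a * Complex.exp (Complex.I *
        ((∑ w, (n w : ℝ) * φ (w.1, w.2.1, Fin.rev w.2.2) : ℝ) : ℂ))) =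
      conj (c.sum (fun n a => a * Complex.exp (Complex.I * ((∑ w, (n w : ℝ) * φ w : ℝ) : ℂ))))) :
    let sh : (TorusSite 2 L × ZMod M) → (Fin r × Fin r × Fin r) → (TorusSite 2 L × ZMod M) :=
      fun s w => (s.1 + ![((w.1 : ℕ) : ZMod L), ((w.2.1 : ℕ) : ZMod L)], s.2 + ((w.2.2 : ℕ) : ZMod M))
    let F : ((Fin r × Fin r × Fin r) → ℝ) → ℂ := fun φ =>
      c.sum (fun n a => a * Complex.exp (Complex.I * ((∑ w, (n w : ℝ) * φ w : ℝ) : ℂ)))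
    let A : ((TorusSite 2 L × ZMod M) → ℝ) → ℂ := fun θ => (K : ℂ) * ∑ s, F (fun w => θ (sh s w))
    let cube : Set ((TorusSite 2 L × ZMod M) → ℝ) := Set.pi Set.univ (fun _ => Set.Icc (0:ℝ) (2 * Real.pi))
    let O : ((TorusSite 2 L × ZMod M) → ℝ) → ℝ := fun θ =>
      ‖∑ x : TorusSite 2 L, Complex.exp (Complex.I * (θ (x, 0) : ℂ))‖ ^ 2 / (L : ℝ) ^ 4
    let N : ℂ := MeasureTheory.integral (MeasureTheory.volume.restrict cube)
      (fun θ => (O θ : ℂ) * Complex.exp (-(A θ)))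
    conj N = N := by
  intro sh F A cube O N
  have hρ : Function.Involutive (fun s : TorusSite 2 L × ZMod M => (s.1, -s.2)) :=
    timeReflection_involutive L M
  refine conj_setIntegral_cube_eq_self (hρ.toPerm _) 0 (2 * Real.pi)
    (fun θ => (O θ : ℂ) * Complex.exp (-(A θ))) ?_
  intro θ
  show (O (fun s => θ (s.1, -s.2)) : ℂ) * Complex.exp (-(A (fun s => θ (s.1, -s.2)))) =
    conj ((O θ : ℂ) * Complex.exp (-(A θ)))
  have hO : O (fun s => θ (s.1, -s.2)) = O θ := by
    show ‖∑ x : TorusSite 2 L, Complex.exp (Complex.I * (θ (x, -0) : ℂ))‖ ^ 2 / (L : ℝ) ^ 4 =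
      ‖∑ x : TorusSite 2 L, Complex.exp (Complex.I * (θ (x, 0) : ℂ))‖ ^ 2 / (L : ℝ) ^ 4
    rw [neg_zero]
  rw [map_mul, Complex.conj_ofReal, hO, ← Complex.exp_conj, map_neg]
  exact congrArg (fun z => (O θ : ℂ) * Complex.exp (-z)) (action_comp_timeReflection r c K L M hR θ)

/-- Elementary bookkeeping for two real complex numbers (`conj z = z`, `conj w = w`): `z ≠ 0` iff
`Re z ≠ 0`, and `Re (w / z) = Re w / Re z`. With `partitionFunction_conj_eq_self` and
`sliceOrderNumerator_conj_eq_self` this turns both conclusions of the engine in the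
time-reflection class into statements about real numbers. -/
theorem re_div_of_conj_eq_self {z w : ℂ} (hz : conj z = z) (hw : conj w = w) :
    (z ≠ 0 ↔ z.re ≠ 0) ∧ (w / z).re = w.re / z.re := by
  have hz' : (z.re : ℂ) = z := Complex.conj_eq_iff_re.mp hz
  have hw' : (w.re : ℂ) = w := Complex.conj_eq_iff_re.mp hw
  constructor
  · rw [← hz']
    exact not_congr Complex.ofReal_eq_zero
  · rw [← hz', ← hw', ← Complex.ofReal_div, Complex.ofReal_re]
    simp

/-- Table form ⇒ functional form of the time-reflection reality hypothesis (R): if the Fourier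
table satisfies `c (n ∘ R) = conj (c (-n))` for every label `n` (`R (w₁,w₂,w₃) = (w₁,w₂,rev w₃)`),
then the local generating function `F φ = Σ_n c_n e^{i n·φ}` satisfies `F (φ ∘ R) = conj (F φ)` for
every real `φ`. -/
theorem timeReflection_functional_of_table (r : ℕ) (c : ((Fin r × Fin r × Fin r) → ℤ) →₀ ℂ)
    (hc : ∀ n : (Fin r × Fin r × Fin r) → ℤ,
      c (fun w => n (w.1, w.2.1, Fin.rev w.2.2)) = conj (c (-n)))
    (φ : (Fin r × Fin r × Fin r) → ℝ) :
    c.sum (fun n a => a * Complex.exp (Complex.I *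
        ((∑ w, (n w : ℝ) * φ (w.1, w.2.1, Fin.rev w.2.2) : ℝ) : ℂ))) =
      conj (c.sum (fun n a => a * Complex.exp (Complex.I * ((∑ w, (n w : ℝ) * φ w : ℝ) : ℂ)))) := by
  -- the temporal reflection of the window, an involution
  set R : (Fin r × Fin r × Fin r) → (Fin r × Fin r × Fin r) :=
    fun w => (w.1, w.2.1, Fin.rev w.2.2) with hRdef
  have hRinv : Function.Involutive R := by
    intro w
    simp [hRdef, Fin.rev_rev]
  -- `T n = -(n ∘ R)`, an involution of the Fourier labels, maps the support of `c` to itself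
  have hTinv : Function.Involutive (fun n : (Fin r × Fin r × Fin r) → ℤ => -(n ∘ R)) := by
    intro n
    funext w
    simp [Function.comp, hRinv w]
  set T : Equiv.Perm ((Fin r × Fin r × Fin r) → ℤ) := hTinv.toPerm _ with hTdef
  have hT : ∀ n w, (T n) w = -(n (R w)) := fun n w => rfl
  have hcT : ∀ n, c (T n) = conj (c n) := by
    intro n
    have h := hc (-n)
    rw [neg_neg] at h
    rw [← h]
    rfl
  have hinner : ∀ n : (Fin r × Fin r × Fin r) → ℤ,
      ∑ w, (n w : ℝ) * φ (w.1, w.2.1, Fin.rev w.2.2) = -∑ w, ((T n) w : ℝ) * φ w := by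
    intro n
    rw [← Finset.sum_neg_distrib]
    refine Fintype.sum_equiv (hRinv.toPerm _) _ _ fun w => ?_
    show (n w : ℝ) * φ (R w) = -(((T n) (R w) : ℝ) * φ (R w))
    rw [hT, hRinv w]
    push_cast
    ring
  simp only [Finsupp.sum, map_sum, map_mul]
  refine Finset.sum_equiv T (fun n => ?_) (fun n _ => ?_)
  · simp only [Finsupp.mem_support_iff, hcT n, map_ne_zero]
  · rw [hcT n, Complex.conj_conj, ← Complex.exp_conj, map_mul, Complex.conj_I, Complex.conj_ofReal]
    rw [hinner n]
    congr 1
    push_cast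
    ring

end Summit.HubbardSuperconductivity.HubbardSuperconductivity.Theorems
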